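import Summits.QuantumFields.YangMills.Theorems.AlphaInputsT3ACv3LinearLiftProfileIds
import HarnessLib

/-!
# `AlphaInputsT3ACv3LinearLiftProfileLip` — (LL) STEP L1-Lip: A LIPSCHITZ ONE-DIMENSIONAL DUAL PROFILE WITH THE SAME EXACT BLOCK AVERAGES
# (tent superposition replacing the two-plateau step `ρ`; slope `O(1/n)`, so that the spread fine curl is Lipschitz at scale `n`) — cell `ym3-torus`, width seat `ym3-torus-px19` (g3),
# line «SYM-CENTRE» row (R3) (LOCATE #56 of seat px20 g2; GO 2026-08-28T22:03:47Z)

WHY.  The landed exact linear lift `AlphaInputsT3ACv3LinearLiftTorus.exists_linearLift_torus` (profiles of `AlphaInputsT3ACv3LinearLiftProfile`) returns a finest one-form with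
EXACT `k`-fold (0.4)-linear averages and fine curls `≤ 18^d·ε/(L^k)²`, but its 1-form profile `τ = ρ(· − h)/n` is a STEP function (jumps `α/n`), so the fine curl
`curl(lift A) = S²(curl A)` is NOT Lipschitz at scale `n = L^k`: `|∂*curl| ~ ε/n²` instead of the `ε/n³` that the divergence clause `DivSmall` of a regular representative
(`T3PrintedRegularMinimiser.RegPr`) demands (LOCATE #56 (V5)).  The whole engine below `…ProfileIds` sees the profile ONLY through `side`, `sigma`, `tau` and the exported rows
(i)–(v), and the weight identity `weightSum_eq` uses of `ρ` only: evenness, support `⊂ [−2p, 2p]`, total mass `n`, vanishing half-moment.  THIS FILE replaces `ρ` by the even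
TENT SUPERPOSITION `ρ_L = c₁·Λ_{p+1} + c₂·Λ_{2p+1}`, `Λ_m(u) = (m − |u|)₊ = Σ_{j<m} 𝟙[|u| ≤ j]`, `c₁ = 4n/(2p²+3p+2)`, `c₂ = −n(p+2)/((2p+1)(2p²+3p+2))` — the unique solution of
{mass `= n`, half-moment `= 0`} in this two-parameter family — which has the same support `[−2p, 2p]`, so that every identity of `…ProfileIds`∕`…Torus1D`∕`…Spread`∕`…Biorth`
holds for it BY THE LANDED PROOFS, plus the new Lipschitz row `|ρ_L(u+1) − ρ_L(u)| ≤ 110/n`.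
* §1 `arad`, `brad`, `cden`, `c1`, `c2`, `plate`, `tent`, `rhoL`, `sigmaL`, `tauL`; plate and tent sums (`sum_rsupp_plate`, `sum_rsupp_plate_pos`, `sum_range_tri`, `sum_rsupp_tent`,
  `sum_rsupp_tent_pos`); `rhoL_neg`, `rhoL_eq_zero`, `abs_rhoL_le` (`≤ 18`), ★ `abs_rhoL_succ_sub_le` (`≤ 110/n`); the two moment identities `sum_rhoL`, `sum_rhoL_pos`.
* §2 ★ `weightSumL_eq` : `Σ_u ρ_L(u)·(n − |jn − u|)₊ = n²·δ_{j0}` (proof = the landed one, by name of `wt_zero`∕`wt_one`∕`wt_neg_one`∕`wt_eq_zero_of_two_le`).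
The identities (i)–(v) for `σ_L`, `τ_L` and the Lipschitz row (vi) `|τ_L(s+1) − τ_L(s)| ≤ 110/n²` are the sibling `AlphaInputsT3ACv3LinearLiftProfileLipIds`.
HONEST FRAMING.  Elementary real∕integer bookkeeping; nothing of [Balaban1985UV3]∕[Balaban1985Variational]∕[Balaban1987RG1] is asserted; count-neutral helper toward the
symmetric-centre row of the EX display (`--supports stmt-QuantumFields-19200`); registry untouched.  YM₃ on the torus is a RUNG of the programme, not the Clay problem; no claim
about d = 4, infinite volume or a mass gap.

References: T. Bałaban, Commun. Math. Phys. 109 (1987) 249–301 [Balaban1987RG1] ((0.4) p.253: the linear block average whose exact right inverse these profiles furnish);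
Commun. Math. Phys. 102 (1985) 277–309 [Balaban1985Variational] (Thm 1 (8) p.279: the regularity window the lift must meet, incl. the divergence clause).
-/

set_option autoImplicit false

noncomputable section

namespace Summit.QuantumFields.YangMills.Theorems.LinearLiftProfileLip

open Finset
open Summit.QuantumFields.YangMills.Theorems.LinearLiftProfile

variable (h : ℕ)

/-! ## §1 The Lipschitz profile -/

/-- The inner tent radius `a = p + 1`. [folklore] -/
def arad : ℕ := prad h + 1

/-- The outer tent radius `b = 2p + 1` (so that the support is `[−2p, 2p]`, as for the landed `ρ`). [folklore] -/
def brad : ℕ := 2 * prad h + 1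

/-- The common denominator `D = 2p² + 3p + 2`. [folklore] -/
def cden : ℝ := 2 * (prad h : ℝ) ^ 2 + 3 * (prad h : ℝ) + 2

/-- The inner tent coefficient `c₁ = 4n/D`. [folklore] -/
def c1 : ℝ := 4 * (side h : ℝ) / cden h

/-- The outer tent coefficient `c₂ = −n(p+2)/((2p+1)D)` (so that the half-moment vanishes). [folklore] -/
def c2 : ℝ := -((side h : ℝ) * ((prad h : ℝ) + 2)) / ((2 * (prad h : ℝ) + 1) * cden h)

/-- The symmetric plateau indicator `𝟙[|u| ≤ j]`. [folklore] -/
def plate (j : ℕ) (u : ℤ) : ℝ := if -(j : ℤ) ≤ u ∧ u ≤ (j : ℤ) then 1 else 0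

/-- The tent `Λ_m(u) = Σ_{j<m} 𝟙[|u| ≤ j] = (m − |u|)₊`. [folklore] -/
def tent (m : ℕ) (u : ℤ) : ℝ := ∑ j ∈ range m, plate j u

/-- **THE LIPSCHITZ DUAL DENSITY `ρ_L = c₁·Λ_{p+1} + c₂·Λ_{2p+1}`** (even, piecewise linear, support `[−2p, 2p]`, mass `n`, vanishing half-moment). [folklore] -/
def rhoL (u : ℤ) : ℝ := c1 h * tent (arad h) u + c2 h * tent (brad h) u

/-- **THE 0-FORM PROFILE `σ_L = (𝟙_{[−h,h]} ∗ ρ_L)/n`.** [folklore] -/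
def sigmaL (s : ℤ) : ℝ := ((side h : ℝ))⁻¹ * ∑ u ∈ rsupp h, rhoL h u * box h (s - u)

/-- **THE 1-FORM PROFILE `τ_L(s) = ρ_L(s − h)/n`.** [folklore] -/
def tauL (s : ℤ) : ℝ := ((side h : ℝ))⁻¹ * rhoL h (s - (h : ℤ))

/-! ### Elementary facts about the parameters -/

/-- `D > 0`. [folklore] -/
theorem cden_pos : 0 < cden h := by unfold cden; positivity

/-- `2p + 1 > 0` over `ℝ`. [folklore] -/
theorem two_prad_succ_pos : (0 : ℝ) < 2 * (prad h : ℝ) + 1 := by positivity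

/-- `c₁ ≥ 0`. [folklore] -/
theorem c1_nonneg : 0 ≤ c1 h := by
  unfold c1; exact div_nonneg (by have := side_real_pos h; positivity) (cden_pos h).le

/-- `c₂ ≤ 0`. [folklore] -/
theorem c2_nonpos : c2 h ≤ 0 := by
  unfold c2
  rw [neg_div]
  exact neg_nonpos.mpr (div_nonneg (by have := side_real_pos h; positivity) (by have := cden_pos h; positivity))

/-- The defining relation of `c₁`: `c₁·D = 4n`. [folklore] -/
theorem c1_mul : c1 h * cden h = 4 * (side h : ℝ) := by
  unfold c1; field_simp [(cden_pos h).ne']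

/-- The defining relation of `c₂`: `c₂·(2p+1)·D = −n(p+2)`. [folklore] -/
theorem c2_mul : c2 h * ((2 * (prad h : ℝ) + 1) * cden h) = -((side h : ℝ) * ((prad h : ℝ) + 2)) := by
  unfold c2; field_simp [(cden_pos h).ne', (two_prad_succ_pos h).ne']

/-- `c₁·(p+1) ≤ 13` (from `n ≤ 6p + 5`). [folklore] -/
theorem c1_mul_arad_le : c1 h * ((prad h : ℝ) + 1) ≤ 13 := by
  have hn : (side h : ℝ) ≤ 6 * (prad h : ℝ) + 5 := by exact_mod_cast (prad_bounds h).2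
  have hp0 : (0 : ℝ) ≤ (prad h : ℝ) := Nat.cast_nonneg _
  have hD := cden_pos h
  have hprod : (side h : ℝ) * ((prad h : ℝ) + 1) ≤ (6 * (prad h : ℝ) + 5) * ((prad h : ℝ) + 1) :=
    mul_le_mul_of_nonneg_right hn (by positivity)
  have key : c1 h * ((prad h : ℝ) + 1) * cden h ≤ 13 * cden h := by
    rw [mul_right_comm, c1_mul]
    unfold cden
    nlinarith [mul_nonneg hp0 hp0, sq_nonneg (2 * (prad h : ℝ) - 5 / 2)]
  exact le_of_mul_le_mul_right key hD

/-- `|c₂|·(2p+1) ≤ 5` (from `n ≤ 6p + 5`). [folklore] -/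
theorem abs_c2_mul_brad_le : |c2 h| * (2 * (prad h : ℝ) + 1) ≤ 5 := by
  rw [abs_of_nonpos (c2_nonpos h)]
  have hn : (side h : ℝ) ≤ 6 * (prad h : ℝ) + 5 := by exact_mod_cast (prad_bounds h).2
  have hp0 : (0 : ℝ) ≤ (prad h : ℝ) := Nat.cast_nonneg _
  have hD := cden_pos h
  have hpp : (prad h : ℝ) ≤ (prad h : ℝ) ^ 2 := by
    rcases Nat.eq_zero_or_pos (prad h) with hp | hp
    · simp [hp]
    · have hp1 : (1 : ℝ) ≤ (prad h : ℝ) := by exact_mod_cast hp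
      nlinarith
  have hprod : (side h : ℝ) * ((prad h : ℝ) + 2) ≤ (6 * (prad h : ℝ) + 5) * ((prad h : ℝ) + 2) :=
    mul_le_mul_of_nonneg_right hn (by positivity)
  have key : -c2 h * (2 * (prad h : ℝ) + 1) * cden h ≤ 5 * cden h := by
    rw [show -c2 h * (2 * (prad h : ℝ) + 1) * cden h = -(c2 h * ((2 * (prad h : ℝ) + 1) * cden h)) by ring, c2_mul]
    unfold cden
    nlinarith [mul_nonneg hp0 hp0]
  exact le_of_mul_le_mul_right key hD

/-- `|c₂| ≤ 2n/D` (since `(p+2)/(2p+1) ≤ 2`). [folklore] -/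
theorem abs_c2_le : |c2 h| ≤ 2 * (side h : ℝ) / cden h := by
  rw [abs_of_nonpos (c2_nonpos h)]
  have hD := cden_pos h
  have h2 := two_prad_succ_pos h
  have hp0 : (0 : ℝ) ≤ (prad h : ℝ) := Nat.cast_nonneg _
  have hn0 := (side_real_pos h).le
  unfold c2
  rw [neg_div, neg_neg, div_le_div_iff₀ (by positivity) hD]
  nlinarith [mul_nonneg (mul_nonneg hn0 hD.le) hp0]

/-- `c₁ + |c₂| ≤ 6n/D`. [folklore] -/
theorem c1_add_abs_c2_le : c1 h + |c2 h| ≤ 6 * (side h : ℝ) / cden h := by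
  have e : c1 h + 2 * (side h : ℝ) / cden h = 6 * (side h : ℝ) / cden h := by
    unfold c1; ring
  rw [← e]
  linarith [abs_c2_le h]

/-- `6n/D ≤ 110/n`, i.e. `6n² ≤ 110·D` (from `n ≤ 6p + 5`). [folklore] -/
theorem six_side_div_cden_le : 6 * (side h : ℝ) / cden h ≤ 110 / side h := by
  have hD := cden_pos h
  have hn := side_real_pos h
  have hnb : (side h : ℝ) ≤ 6 * (prad h : ℝ) + 5 := by exact_mod_cast (prad_bounds h).2
  have hp0 : (0 : ℝ) ≤ (prad h : ℝ) := Nat.cast_nonneg _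
  rw [div_le_div_iff₀ hD hn]
  unfold cden
  have hsq : (side h : ℝ) * (side h : ℝ) ≤ (6 * (prad h : ℝ) + 5) * (6 * (prad h : ℝ) + 5) := mul_le_mul hnb hnb hn.le (by positivity)
  nlinarith [hsq, sq_nonneg (2 * (prad h : ℝ) - 15 / 2)]

/-! ### Plateaus and tents -/

/-- `0 ≤ 𝟙[|u| ≤ j] ≤ 1`. [folklore] -/
theorem plate_nonneg (j : ℕ) (u : ℤ) : 0 ≤ plate j u := by unfold plate; split_ifs <;> norm_num

/-- `𝟙[|u| ≤ j] ≤ 1`. [folklore] -/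
theorem plate_le_one (j : ℕ) (u : ℤ) : plate j u ≤ 1 := by unfold plate; split_ifs <;> norm_num

/-- The plateau is even. [folklore] -/
theorem plate_neg (j : ℕ) (u : ℤ) : plate j (-u) = plate j u := by
  unfold plate
  by_cases h1 : -(j : ℤ) ≤ u ∧ u ≤ (j : ℤ)
  · rw [if_pos h1, if_pos (by omega)]
  · rw [if_neg h1, if_neg (by omega)]

/-- The plateau vanishes off `[−j, j]`. [folklore] -/
theorem plate_eq_zero {j : ℕ} {u : ℤ} (hu : ¬ (-(j : ℤ) ≤ u ∧ u ≤ (j : ℤ))) : plate j u = 0 := by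
  unfold plate; rw [if_neg hu]

/-- `0 ≤ Λ_m`. [folklore] -/
theorem tent_nonneg (m : ℕ) (u : ℤ) : 0 ≤ tent m u := sum_nonneg fun j _ => plate_nonneg j u

/-- `Λ_m ≤ m`. [folklore] -/
theorem tent_le (m : ℕ) (u : ℤ) : tent m u ≤ m := by
  unfold tent
  calc ∑ j ∈ range m, plate j u ≤ ∑ _j ∈ range m, (1 : ℝ) := sum_le_sum fun j _ => plate_le_one j u
    _ = m := by simp

/-- The tent is even. [folklore] -/
theorem tent_neg (m : ℕ) (u : ℤ) : tent m (-u) = tent m u := by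
  unfold tent; exact sum_congr rfl fun j _ => plate_neg j u

/-- The tent vanishes off `(−m, m)`. [folklore] -/
theorem tent_eq_zero {m : ℕ} {u : ℤ} (hu : ¬ (-((m : ℤ) - 1) ≤ u ∧ u ≤ (m : ℤ) - 1)) : tent m u = 0 := by
  unfold tent
  refine sum_eq_zero fun j hj => ?_
  rw [mem_range] at hj
  exact plate_eq_zero (by omega)

/-- The discrete derivative of a tent on the right half-line: `Λ_m(u+1) − Λ_m(u) = −𝟙[u < m]` for `u ≥ 0`. [folklore] -/
theorem tent_succ_sub (m : ℕ) {u : ℤ} (hu : 0 ≤ u) : tent m (u + 1) - tent m u = -(if u < (m : ℤ) then 1 else 0) := by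
  unfold tent
  rw [← sum_sub_distrib]
  have e : ∀ j ∈ range m, plate j (u + 1) - plate j u = -(if j = u.toNat then (1 : ℝ) else 0) := by
    intro j _
    unfold plate
    by_cases hj : j = u.toNat
    · rw [if_pos hj, if_neg (by omega), if_pos (by omega)]; ring
    · rw [if_neg hj]
      by_cases h2 : -(j : ℤ) ≤ u ∧ u ≤ (j : ℤ)
      · rw [if_pos h2, if_pos (by omega)]; ring
      · rw [if_neg h2, if_neg (by omega)]; ring
  rw [sum_congr rfl e, sum_neg_distrib, sum_ite_eq']
  congr 1
  by_cases hum : u < (m : ℤ)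
  · rw [if_pos hum, if_pos (by rw [mem_range]; omega)]
  · rw [if_neg hum, if_neg (by rw [mem_range]; omega)]

/-- The tent is `1`-Lipschitz. [folklore] -/
theorem abs_tent_succ_sub_le (m : ℕ) (u : ℤ) : |tent m (u + 1) - tent m u| ≤ 1 := by
  rcases le_or_gt 0 u with hu | hu
  · rw [tent_succ_sub m hu]; split_ifs <;> norm_num
  · have e : tent m (u + 1) - tent m u = -(tent m (-(u + 1) + 1) - tent m (-(u + 1))) := by
      rw [show -(u + 1) + 1 = -u by ring, tent_neg, tent_neg]; ring
    rw [e, abs_neg, tent_succ_sub m (by omega)]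
    split_ifs <;> norm_num

/-! ### Plate and tent sums over the support -/

/-- `Σ_{u ∈ [−2p,2p]} 𝟙[|u| ≤ j]·f(u) = Σ_{|u| ≤ j} f(u)` for `j ≤ 2p`. [folklore] -/
theorem sum_rsupp_plate_mul (f : ℤ → ℝ) {j : ℕ} (hj : j ≤ 2 * prad h) :
    ∑ u ∈ rsupp h, plate j u * f u = ∑ u ∈ Icc (-(j : ℤ)) (j : ℤ), f u := by
  unfold plate
  simp_rw [ite_mul, one_mul, zero_mul]
  rw [← sum_filter]
  congr 1
  ext u
  simp only [rsupp, mem_filter, mem_Icc]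
  omega

/-- `Σ_{u ∈ [−2p,2p]} 𝟙[|u| ≤ j] = 2j + 1` for `j ≤ 2p`. [folklore] -/
theorem sum_rsupp_plate {j : ℕ} (hj : j ≤ 2 * prad h) : ∑ u ∈ rsupp h, plate j u = 2 * (j : ℝ) + 1 := by
  have e := sum_rsupp_plate_mul h (fun _ => (1 : ℝ)) hj
  simp only [mul_one] at e
  rw [e, sum_Icc_symm_one]

/-- `Σ_{u ∈ [−2p,2p]} 𝟙[|u| ≤ j]·u₊ = j(j+1)/2` for `j ≤ 2p`. [folklore] -/
theorem sum_rsupp_plate_pos {j : ℕ} (hj : j ≤ 2 * prad h) :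
    ∑ u ∈ rsupp h, plate j u * ((max u 0 : ℤ) : ℝ) = (j : ℝ) * ((j : ℝ) + 1) / 2 := by
  rw [sum_rsupp_plate_mul h _ hj, sum_Icc_symm_pos]

/-- `Σ_{j<m} j(j+1)/2 = (m−1)m(m+1)/6`. [folklore] -/
theorem sum_range_tri (m : ℕ) : ∑ j ∈ range m, ((j : ℝ) * ((j : ℝ) + 1) / 2) = ((m : ℝ) - 1) * m * ((m : ℝ) + 1) / 6 := by
  induction m with
  | zero => simp
  | succ m ih => rw [sum_range_succ, ih]; push_cast; ring

/-- **TENT MASS** `Σ_{u ∈ [−2p,2p]} Λ_m(u) = m²` for `m ≤ 2p + 1`. [folklore] -/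
theorem sum_rsupp_tent {m : ℕ} (hm : m ≤ 2 * prad h + 1) : ∑ u ∈ rsupp h, tent m u = (m : ℝ) ^ 2 := by
  -- `Σ_{j<m} (2j+1) = m²` (in the tree as `Literature.MathematicalPhysics.QuantumLattice.sum_range_two_mul_cast_add_one`; re-derived inline to keep the import closure small)
  have hodd : ∀ m' : ℕ, ∑ j ∈ range m', (2 * (j : ℝ) + 1) = (m' : ℝ) ^ 2 := by
    intro m'
    induction m' with
    | zero => simp
    | succ m' ih => rw [sum_range_succ, ih]; push_cast; ring
  unfold tent
  rw [sum_comm, ← hodd]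
  refine sum_congr rfl fun j hj => ?_
  rw [mem_range] at hj
  exact sum_rsupp_plate h (by omega)

/-- **TENT HALF-MOMENT** `Σ_{u ∈ [−2p,2p]} Λ_m(u)·u₊ = (m−1)m(m+1)/6` for `m ≤ 2p + 1`. [folklore] -/
theorem sum_rsupp_tent_pos {m : ℕ} (hm : m ≤ 2 * prad h + 1) :
    ∑ u ∈ rsupp h, tent m u * ((max u 0 : ℤ) : ℝ) = ((m : ℝ) - 1) * m * ((m : ℝ) + 1) / 6 := by
  unfold tent
  simp_rw [sum_mul]
  rw [sum_comm, ← sum_range_tri]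
  refine sum_congr rfl fun j hj => ?_
  rw [mem_range] at hj
  exact sum_rsupp_plate_pos h (by omega)

/-! ### The profile: symmetry, support, bounds -/

/-- `ρ_L` is even. [folklore] -/
theorem rhoL_neg (u : ℤ) : rhoL h (-u) = rhoL h u := by
  unfold rhoL; rw [tent_neg, tent_neg]

/-- `ρ_L` vanishes off `[−2p, 2p]`. [folklore] -/
theorem rhoL_eq_zero {u : ℤ} (hu : ¬ (-(2 * (prad h : ℤ)) ≤ u ∧ u ≤ 2 * (prad h : ℤ))) : rhoL h u = 0 := by
  unfold rhoL
  rw [tent_eq_zero (by unfold arad; push_cast; omega), tent_eq_zero (by unfold brad; push_cast; omega), mul_zero, mul_zero, add_zero]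

/-- `|ρ_L| ≤ 18` (crude: `c₁(p+1) + |c₂|(2p+1) ≤ 13 + 5`). [folklore] -/
theorem abs_rhoL_le (u : ℤ) : |rhoL h u| ≤ 18 := by
  unfold rhoL
  have h1 := c1_nonneg h
  have ha := tent_le (arad h) u; have ha0 := tent_nonneg (arad h) u
  have hb := tent_le (brad h) u; have hb0 := tent_nonneg (brad h) u
  have e1 : |c1 h * tent (arad h) u| ≤ 13 := by
    rw [abs_mul, abs_of_nonneg h1, abs_of_nonneg ha0]
    calc c1 h * tent (arad h) u ≤ c1 h * (arad h : ℝ) := mul_le_mul_of_nonneg_left ha h1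
      _ = c1 h * ((prad h : ℝ) + 1) := by unfold arad; push_cast; ring
      _ ≤ 13 := c1_mul_arad_le h
  have e2 : |c2 h * tent (brad h) u| ≤ 5 := by
    rw [abs_mul, abs_of_nonneg hb0]
    calc |c2 h| * tent (brad h) u ≤ |c2 h| * (brad h : ℝ) := mul_le_mul_of_nonneg_left hb (abs_nonneg _)
      _ = |c2 h| * (2 * (prad h : ℝ) + 1) := by unfold brad; push_cast; ring
      _ ≤ 5 := abs_c2_mul_brad_le h
  calc |c1 h * tent (arad h) u + c2 h * tent (brad h) u| ≤ |c1 h * tent (arad h) u| + |c2 h * tent (brad h) u| := abs_add_le _ _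
    _ ≤ 13 + 5 := add_le_add e1 e2
    _ = 18 := by norm_num

/-- **★ (vi) THE LIPSCHITZ ROW**: `|ρ_L(u+1) − ρ_L(u)| ≤ 110/n` — the slope of the tent superposition is `O(1/n)` (the landed step profile jumps by `α = O(1)`). [folklore] -/
theorem abs_rhoL_succ_sub_le (u : ℤ) : |rhoL h (u + 1) - rhoL h u| ≤ 110 / side h := by
  have e : rhoL h (u + 1) - rhoL h u = c1 h * (tent (arad h) (u + 1) - tent (arad h) u) + c2 h * (tent (brad h) (u + 1) - tent (brad h) u) := by
    unfold rhoL; ring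
  rw [e]
  calc |c1 h * (tent (arad h) (u + 1) - tent (arad h) u) + c2 h * (tent (brad h) (u + 1) - tent (brad h) u)|
      ≤ |c1 h * (tent (arad h) (u + 1) - tent (arad h) u)| + |c2 h * (tent (brad h) (u + 1) - tent (brad h) u)| := abs_add_le _ _
    _ ≤ c1 h * 1 + |c2 h| * 1 := by
        rw [abs_mul, abs_mul, abs_of_nonneg (c1_nonneg h)]
        exact add_le_add (mul_le_mul_of_nonneg_left (abs_tent_succ_sub_le _ _) (c1_nonneg h))
          (mul_le_mul_of_nonneg_left (abs_tent_succ_sub_le _ _) (abs_nonneg _))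
    _ = c1 h + |c2 h| := by ring
    _ ≤ 6 * (side h : ℝ) / cden h := c1_add_abs_c2_le h
    _ ≤ 110 / side h := six_side_div_cden_le h

/-! ### The two moment identities -/

/-- **TOTAL MASS `Σ ρ_L = n`** (`c₁(p+1)² + c₂(2p+1)² = n`). [folklore] -/
theorem sum_rhoL : ∑ u ∈ rsupp h, rhoL h u = side h := by
  unfold rhoL
  rw [sum_add_distrib, ← mul_sum, ← mul_sum, sum_rsupp_tent h (by unfold arad; omega), sum_rsupp_tent h (by unfold brad; omega)]
  unfold arad brad c1 c2 cden
  push_cast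
  have hD : (2 * (prad h : ℝ) ^ 2 + 3 * (prad h : ℝ) + 2) ≠ 0 := by positivity
  have h2 : (2 * (prad h : ℝ) + 1) ≠ 0 := by positivity
  field_simp
  ring

/-- **VANISHING HALF-MOMENT `Σ u₊ ρ_L(u) = 0`** (`c₁·p(p+1)(p+2)/6 + c₂·2p(2p+1)(2p+2)/6 = 0`). [folklore] -/
theorem sum_rhoL_pos : ∑ u ∈ rsupp h, rhoL h u * ((max u 0 : ℤ) : ℝ) = 0 := by
  unfold rhoL
  simp_rw [add_mul, mul_assoc]
  rw [sum_add_distrib, ← mul_sum, ← mul_sum, sum_rsupp_tent_pos h (by unfold arad; omega), sum_rsupp_tent_pos h (by unfold brad; omega)]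
  unfold arad brad c1 c2 cden
  push_cast
  have hD : (2 * (prad h : ℝ) ^ 2 + 3 * (prad h : ℝ) + 2) ≠ 0 := by positivity
  have h2 : (2 * (prad h : ℝ) + 1) ≠ 0 := by positivity
  field_simp
  ring

/-- By reflection, `Σ (−u)₊ ρ_L(u) = 0` as well. [folklore] -/
theorem sum_rhoL_neg_pos : ∑ u ∈ rsupp h, rhoL h u * ((max (-u) 0 : ℤ) : ℝ) = 0 := by
  have e := sum_rsupp_neg h (fun v => rhoL h (-v) * ((max v 0 : ℤ) : ℝ))
  simp only [neg_neg] at e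
  rw [e]
  simp_rw [rhoL_neg]
  exact sum_rhoL_pos h

/-! ## §2 The weight identity `Σ_u ρ_L(u)(n − |jn − u|)₊ = n²·δ_{j0}` -/

/-- **★ THE WEIGHT IDENTITY** for the Lipschitz profile: `Σ_u ρ_L(u)·(n − |jn − u|)₊ = n²` for `j = 0` and `0` otherwise — exact block averages (cell sums of `σ_L`) and
exact segment means (of `τ_L`) both reduce to it. [folklore] -/
theorem weightSumL_eq (j : ℤ) : ∑ u ∈ rsupp h, rhoL h u * (wt h j u : ℝ) = if j = 0 then (side h : ℝ) ^ 2 else 0 := by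
  by_cases hj0 : j = 0
  · subst hj0
    rw [if_pos rfl]
    calc ∑ u ∈ rsupp h, rhoL h u * (wt h 0 u : ℝ)
        = ∑ u ∈ rsupp h, ((side h : ℝ) * rhoL h u - rhoL h u * ((max u 0 : ℤ) : ℝ) - rhoL h u * ((max (-u) 0 : ℤ) : ℝ)) := by
          refine sum_congr rfl fun u hu => ?_
          rw [wt_zero h hu]; ring
      _ = (side h : ℝ) * ∑ u ∈ rsupp h, rhoL h u - ∑ u ∈ rsupp h, rhoL h u * ((max u 0 : ℤ) : ℝ)
            - ∑ u ∈ rsupp h, rhoL h u * ((max (-u) 0 : ℤ) : ℝ) := by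
          rw [sum_sub_distrib, sum_sub_distrib, mul_sum]
      _ = (side h : ℝ) ^ 2 := by rw [sum_rhoL, sum_rhoL_pos, sum_rhoL_neg_pos]; ring
  · rw [if_neg hj0]
    by_cases hj1 : j = 1
    · subst hj1
      calc ∑ u ∈ rsupp h, rhoL h u * (wt h 1 u : ℝ) = ∑ u ∈ rsupp h, rhoL h u * ((max u 0 : ℤ) : ℝ) :=
            sum_congr rfl fun u hu => by rw [wt_one h hu]
        _ = 0 := sum_rhoL_pos h
    · by_cases hjm : j = -1
      · subst hjm
        calc ∑ u ∈ rsupp h, rhoL h u * (wt h (-1) u : ℝ) = ∑ u ∈ rsupp h, rhoL h u * ((max (-u) 0 : ℤ) : ℝ) :=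
              sum_congr rfl fun u hu => by rw [wt_neg_one h hu]
          _ = 0 := sum_rhoL_neg_pos h
      · have hj2 : 2 ≤ |j| := by
          by_cases h0 : 0 ≤ j
          · rw [abs_of_nonneg h0]; omega
          · rw [abs_of_neg (lt_of_not_ge h0)]; omega
        exact sum_eq_zero fun u hu => by rw [wt_eq_zero_of_two_le h hu hj2]; simp

end Summit.QuantumFields.YangMills.Theorems.LinearLiftProfileLip

end
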